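import Summits.BirchSwinnertonDyer.BirchSwinnertonDyer.Theorems.ManinLocalTwoThreeVertexAssembly
import Summits.BirchSwinnertonDyer.BirchSwinnertonDyer.Theorems.ManinLocalTwoThreeHeckeTransport
import Literature.NumberTheory.EllipticCurves.ModularCurveGamma0IndexProofs
import HarnessLib

/-!
# Toward E-es-41m for ODD `t`: reduction `Γ₀(L′) ↠ SL₂(ℤ/t)`, its kernel, and `Γ₀(L′)`-invariance of `u₁` on the kernel

Summit `BirchSwinnertonDyer`, route `ManinLocalTwoThree` (cell bsd-f2-manin), crux C2 `ManinOddAtFour` (stmt-BirchSwinnertonDyer-22967),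
line `kato_shift_two` v6, stub 3 `stub_cThreeImageResidual`; MEMO-es §25.10 (V-a) for `t` odd and §25.12 (6) «[t odd] EXT-CRIT
(F-es-27 FACT)».  The vertex-step EXTENSION for an odd prime `t ∤ L′`: a `t`-shift-invariant homomorphism `u₁` on
`B = Γ₀(L′t)` restricts to a `Γ₀(L′)`-INVARIANT homomorphism on `N = Γ₀(L′) ∩ Γ(t) = ker(Γ₀(L′) → SL₂(ℤ/t))`, to which the
characteristic-`2` extension criterion for `SL₂(𝔽_t)`-quotients (F-es-27′: `H²(SL₂(𝔽_t); 𝔽₂) = 0`, Hochschild–Serre) applies.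
This file (prelude; the extension itself is in `Theorems/ManinLocalTwoThreeVertexExtensionOdd.lean`):

* `exists_Gamma0_reduce_eq` — `Γ₀(L′) → SL₂(ℤ/t)` is ONTO for `t`, `L′` coprime (CRT `ℤ/(tL′) ≅ ℤ/t × ℤ/L′` + the tree's
  `specialLinearGroup_map_surjective`: lift `(A, 1)`).
* `reduce_eq_one_iff` — the kernel on entries; `dvd_level_of_reduce_eq_one` — `N ⊆ Γ₀(L′t)`.
* `shiftRelMat_inv` — the entrywise shift relation `X = A_t Y A_t⁻¹` passes to inverses in `SL₂(ℤ)`.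
* **`conj_invariant_of_shiftInvariant`** — for `u₁ ∈ Z⁰(Γ₀(L′t), K)` `t`-shift-invariant, `g ∈ Γ₀(L′)` and `n ∈ N`:
  `u₁(g n g⁻¹) = u₁(n)` (§25.10 CHECK 1 in final form: for `g ∈ B` a class-function identity; for `t ∣ b_g` shift `g`, `n` down
  by `A_t`, conjugate inside `B`, shift up; in general `g ∈ B·B⁻·B` explicitly via `T^x`).

No new definitions (the reduction map enters as a parameter `π` with its defining equation); nothing about BSD or Manin's
conjecture is proved here.

References: G. Shimura (1971) §8.3, Lemma 1.38 [cite: Shimura1971, §8.3 (8.3.2)]; cell memo HOME/MEMO-es.md §25.10–§25.12.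
-/

set_option autoImplicit false
set_option linter.dupNamespace false

open scoped MatrixGroups

open CongruenceSubgroup Literature.NumberTheory.EllipticCurves.ModularForms
  Literature.NumberTheory.EllipticCurves.ModularForms.HidaCohomology
  Summit.BirchSwinnertonDyer.Rank1Residual.ManinAdditive

namespace Summit.BirchSwinnertonDyer.BirchSwinnertonDyer.Theorems.ManinLocalTwoThree

noncomputable section

/-! ### §1  `Γ₀(L′) ↠ SL₂(ℤ/t)` for `gcd(t, L′) = 1` -/

section Reduction

/-- **`Γ₀(L′) → SL₂(ℤ/t)` is surjective** when `t`, `L′` are coprime: by CRT `ℤ/(tL′) ≅ ℤ/t × ℤ/L′`, lift the pair `(A, 1)`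
to `SL₂(ℤ/(tL′))` and then to `SL₂(ℤ)` (Shimura Lemma 1.38, the tree's `specialLinearGroup_map_surjective`); the lift is
`≡ 1 (mod L′)`, so it lies in `Γ₀(L′)`. [cite: Shimura1971, §8.3 (8.3.2)] -/
theorem exists_Gamma0_reduce_eq {t L' : ℕ} [NeZero t] [NeZero L'] (hcop : Nat.Coprime t L') (A : SL(2, ZMod t)) :
    ∃ γ : SL(2, ℤ), γ ∈ Gamma0 L' ∧ Matrix.SpecialLinearGroup.map (Int.castRingHom (ZMod t)) γ = A := by
  classical
  let e : ZMod (t * L') ≃+* ZMod t × ZMod L' := ZMod.chineseRemainder hcop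
  -- the pair `(A, 1)` as a matrix over `ℤ/t × ℤ/L′`
  let M : Matrix (Fin 2) (Fin 2) (ZMod t × ZMod L') :=
    fun i j => ((A : Matrix (Fin 2) (Fin 2) (ZMod t)) i j, (1 : Matrix (Fin 2) (Fin 2) (ZMod L')) i j)
  have hMfst : M.map Prod.fst = (A : Matrix (Fin 2) (Fin 2) (ZMod t)) := rfl
  have hMsnd : M.map Prod.snd = 1 := rfl
  have hMdet : M.det = 1 := by
    refine Prod.ext ?_ ?_
    · have h := RingHom.map_det (RingHom.fst (ZMod t) (ZMod L')) M
      rw [RingHom.mapMatrix_apply] at h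
      change (M.det).1 = 1
      rw [show (M.det).1 = RingHom.fst (ZMod t) (ZMod L') M.det from rfl, h]
      change (M.map Prod.fst).det = 1
      rw [hMfst]; exact A.det_coe
    · have h := RingHom.map_det (RingHom.snd (ZMod t) (ZMod L')) M
      rw [RingHom.mapMatrix_apply] at h
      change (M.det).2 = 1
      rw [show (M.det).2 = RingHom.snd (ZMod t) (ZMod L') M.det from rfl, h]
      change (M.map Prod.snd).det = 1
      rw [hMsnd]; exact Matrix.det_one
  let B : SL(2, ZMod (t * L')) := ⟨M.map e.symm, by
    have h := RingHom.map_det (e.symm : ZMod t × ZMod L' →+* ZMod (t * L')) M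
    rw [RingHom.mapMatrix_apply, hMdet, map_one] at h
    exact h.symm⟩
  haveI : NeZero (t * L') := ⟨mul_ne_zero (NeZero.ne t) (NeZero.ne L')⟩
  obtain ⟨γ, hγ⟩ := specialLinearGroup_map_surjective (t * L') B
  -- entries of `γ` modulo `t L′`
  have hent : ∀ i j : Fin 2, (((γ i j : ℤ)) : ZMod (t * L')) = e.symm (M i j) := by
    intro i j
    have := congrArg (fun X : SL(2, ZMod (t * L')) => X i j) hγ
    have h' : (((γ i j : ℤ)) : ZMod (t * L')) = (B : Matrix (Fin 2) (Fin 2) (ZMod (t * L'))) i j := by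
      simpa using this
    exact h'.trans rfl
  have hee : ∀ x : ZMod (t * L'), e x = ((ZMod.cast x : ZMod t), (ZMod.cast x : ZMod L')) := by
    intro x
    show (ZMod.cast x : ZMod t × ZMod L') = _
    exact Prod.ext (Prod.fst_zmod_cast x) (Prod.snd_zmod_cast x)
  have htd : t ∣ t * L' := Dvd.intro _ rfl
  have hLd : L' ∣ t * L' := Dvd.intro_left _ rfl
  have hmodt : ∀ i j : Fin 2, (((γ i j : ℤ)) : ZMod t) = (A : Matrix (Fin 2) (Fin 2) (ZMod t)) i j := by
    intro i j
    have h1 : (ZMod.cast ((((γ i j : ℤ)) : ZMod (t * L'))) : ZMod t) = ((γ i j : ℤ) : ZMod t) := ZMod.cast_intCast htd _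
    rw [← h1, hent]
    have h2 := congrArg Prod.fst (hee (e.symm (M i j)))
    rw [RingEquiv.apply_symm_apply] at h2
    exact h2.symm
  have hmodL : (((γ 1 0 : ℤ)) : ZMod L') = 0 := by
    have h1 : (ZMod.cast ((((γ 1 0 : ℤ)) : ZMod (t * L'))) : ZMod L') = ((γ 1 0 : ℤ) : ZMod L') := ZMod.cast_intCast hLd _
    rw [← h1, hent]
    have h2 := congrArg Prod.snd (hee (e.symm (M 1 0)))
    rw [RingEquiv.apply_symm_apply] at h2
    have h3 : (ZMod.cast (e.symm (M 1 0)) : ZMod L') = (M 1 0).2 := h2.symm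
    rw [h3]
    show (1 : Matrix (Fin 2) (Fin 2) (ZMod L')) 1 0 = 0
    simp
  refine ⟨γ, by rw [Gamma0_mem]; exact hmodL, ?_⟩
  ext i j
  rw [SL_reduction_mod_hom_val]
  exact hmodt i j

end Reduction

/-! ### §2  The kernel of reduction on entries -/

section Kernel

variable {t L' : ℕ}

/-- `γ ≡ 1 (mod t)` entrywise iff its reduction is `1`. [folklore] -/
theorem reduce_eq_one_iff (γ : SL(2, ℤ)) :
    Matrix.SpecialLinearGroup.map (Int.castRingHom (ZMod t)) γ = 1 ↔
      (((γ 0 0 : ℤ)) : ZMod t) = 1 ∧ (((γ 0 1 : ℤ)) : ZMod t) = 0 ∧ (((γ 1 0 : ℤ)) : ZMod t) = 0 ∧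
        (((γ 1 1 : ℤ)) : ZMod t) = 1 := by
  constructor
  · intro h
    have e : ∀ i j : Fin 2, (((γ i j : ℤ)) : ZMod t) = (1 : Matrix (Fin 2) (Fin 2) (ZMod t)) i j := by
      intro i j
      have := congrArg (fun X : SL(2, ZMod t) => X i j) h
      simpa using this
    exact ⟨by simpa using e 0 0, by simpa using e 0 1, by simpa using e 1 0, by simpa using e 1 1⟩
  · rintro ⟨h1, h2, h3, h4⟩
    ext i j
    rw [SL_reduction_mod_hom_val]
    fin_cases i <;> fin_cases j <;> simp [h1, h2, h3, h4]

/-- An element of `Γ₀(L′)` which is `≡ 1 (mod t)` lies in `Γ₀(L′t)` (`t`, `L′` coprime). [folklore] -/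
theorem dvd_level_of_reduce_eq_one (hcop : Nat.Coprime t L') (γ : Gamma0 L')
    (h10 : ((((γ : SL(2, ℤ)) 1 0 : ℤ)) : ZMod t) = 0) : ((L' * t : ℕ) : ℤ) ∣ (γ : SL(2, ℤ)) 1 0 := by
  have ht : (t : ℤ) ∣ (γ : SL(2, ℤ)) 1 0 := (ZMod.intCast_zmod_eq_zero_iff_dvd _ _).1 h10
  have hL : (L' : ℤ) ∣ (γ : SL(2, ℤ)) 1 0 := ManinFrameResidueProperRTameTwist.natCast_dvd_entry10 γ
  push_cast
  exact Int.isCoprime_iff_gcd_eq_one.mpr (by rw [Int.gcd_natCast_natCast]; exact hcop.symm) |>.mul_dvd hL ht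

/-- Membership in `Γ₀(L′t)` from the divisibility (plumbing). [folklore] -/
theorem mem_Gamma0_mul_of_dvd (γ : SL(2, ℤ)) (h : ((L' * t : ℕ) : ℤ) ∣ γ 1 0) : γ ∈ Gamma0 (L' * t) := by
  rw [Gamma0_mem]; exact (ZMod.intCast_zmod_eq_zero_iff_dvd _ _).2 h

end Kernel

/-! ### §3  The shift relation on inverses; shifting a kernel element down -/

section Shift

variable (t : ℤ)

/-- Entries of the inverse in `SL₂(ℤ)` (plumbing). [folklore] -/
theorem inv_apply_zero_zero (h : SL(2, ℤ)) : (h⁻¹) 0 0 = h 1 1 := by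
  rw [Matrix.SpecialLinearGroup.SL2_inv_expl]; rfl

/-- Entries of the inverse in `SL₂(ℤ)` (plumbing). [folklore] -/
theorem inv_apply_zero_one (h : SL(2, ℤ)) : (h⁻¹) 0 1 = -h 0 1 := by
  rw [Matrix.SpecialLinearGroup.SL2_inv_expl]; rfl

/-- The shift relation `X = diag(t,1) Y diag(t,1)⁻¹` (entrywise) passes to inverses in `SL₂(ℤ)`. [folklore] -/
theorem shiftRelMat_inv {X Y : SL(2, ℤ)}
    (h : X 0 0 = Y 0 0 ∧ X 0 1 = t * Y 0 1 ∧ t * X 1 0 = Y 1 0 ∧ X 1 1 = Y 1 1) :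
    (X⁻¹) 0 0 = (Y⁻¹) 0 0 ∧ (X⁻¹) 0 1 = t * (Y⁻¹) 0 1 ∧ t * (X⁻¹) 1 0 = (Y⁻¹) 1 0 ∧ (X⁻¹) 1 1 = (Y⁻¹) 1 1 := by
  obtain ⟨h1, h2, h3, h4⟩ := h
  rw [inv_apply_zero_zero, inv_apply_zero_zero, inv_apply_zero_one, inv_apply_zero_one, inv_apply_one_zero,
    inv_apply_one_zero, inv_apply_one_one, inv_apply_one_one]
  exact ⟨h4, by rw [h2]; ring, by rw [← h3]; ring, h1⟩

end Shift

/-! ### §4  `Γ₀(L′)`-invariance of `u₁` on `N = Γ₀(L′) ∩ Γ(t)` -/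

section Invariance

variable {t L' : ℕ} {K : Type*} [CommRing K]

/-- **Shifting down inside `Γ₀(L′)`.**  An element `X ∈ Γ₀(L′)` with `t ∣ X₀₁` is the `t`-shift `A_t Y A_t⁻¹` of some
`Y = (X₀₀, X₀₁/t; tX₁₀, X₁₁) ∈ Γ₀(L′t)`. [folklore] -/
theorem exists_shiftDown (X : Gamma0 L') (hb : (t : ℤ) ∣ (X : SL(2, ℤ)) 0 1) :
    ∃ Y : Gamma0 (L' * t), (X : SL(2, ℤ)) 0 0 = (Y : SL(2, ℤ)) 0 0 ∧ (X : SL(2, ℤ)) 0 1 = (t : ℤ) * (Y : SL(2, ℤ)) 0 1 ∧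
      (t : ℤ) * (X : SL(2, ℤ)) 1 0 = (Y : SL(2, ℤ)) 1 0 ∧ (X : SL(2, ℤ)) 1 1 = (Y : SL(2, ℤ)) 1 1 := by
  obtain ⟨Ym, hrel⟩ := exists_shiftRelMat_down (t : ℤ) (X := ((X : SL(2, ℤ)) : Matrix (Fin 2) (Fin 2) ℤ)) hb
  have hdet : Ym.det = 1 := by
    rw [← shiftRelMat_det (t : ℤ) hrel]; exact (X : SL(2, ℤ)).det_coe
  have hY10 : ((L' * t : ℕ) : ℤ) ∣ Ym 1 0 := by
    rw [← hrel.2.2.1]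
    push_cast
    rw [mul_comm (L' : ℤ)]
    exact mul_dvd_mul_left _ (ManinFrameResidueProperRTameTwist.natCast_dvd_entry10 X)
  exact ⟨⟨⟨Ym, hdet⟩, mem_Gamma0_mul_of_dvd _ hY10⟩, hrel⟩

/-- Kernel elements conjugate into `Γ₀(L′t)`: if `n ≡ 1 (mod t)` then `g n g⁻¹ ≡ 1 (mod t)`, so `L′t ∣ (g n g⁻¹)₁₀`
(plumbing through the reduction map). [folklore] -/
theorem dvd_level_conj_of_reduce_eq_one (hcop : Nat.Coprime t L') (g n : Gamma0 L')
    (hn1 : Matrix.SpecialLinearGroup.map (Int.castRingHom (ZMod t)) (n : SL(2, ℤ)) = 1) :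
    Matrix.SpecialLinearGroup.map (Int.castRingHom (ZMod t)) ((g * n * g⁻¹ : Gamma0 L') : SL(2, ℤ)) = 1 ∧
      ((L' * t : ℕ) : ℤ) ∣ ((g * n * g⁻¹ : Gamma0 L') : SL(2, ℤ)) 1 0 := by
  have h1 : Matrix.SpecialLinearGroup.map (Int.castRingHom (ZMod t)) ((g * n * g⁻¹ : Gamma0 L') : SL(2, ℤ)) = 1 := by
    push_cast
    rw [map_mul, map_mul, map_inv, hn1, mul_one, mul_inv_cancel]
  exact ⟨h1, dvd_level_of_reduce_eq_one hcop _ ((reduce_eq_one_iff _).1 h1).2.2.1⟩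

variable {u : Gamma0 (L' * t) → Fin 1 → K} (hu : u ∈ cocycles 0 (L' * t) K)

include hu

/-- **`u₁(g n g⁻¹) = u₁(n)` for `g ∈ Γ₀(L′t)`**: `u₁` is a class function on `Γ₀(L′t)`. [folklore] -/
theorem conj_invariant_of_dvd_c (g n : Gamma0 L') (hgc : ((L' * t : ℕ) : ℤ) ∣ (g : SL(2, ℤ)) 1 0)
    (hn : ((L' * t : ℕ) : ℤ) ∣ (n : SL(2, ℤ)) 1 0) (hgn : ((L' * t : ℕ) : ℤ) ∣ ((g * n * g⁻¹ : Gamma0 L') : SL(2, ℤ)) 1 0) :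
    u ⟨((g * n * g⁻¹ : Gamma0 L') : SL(2, ℤ)), mem_Gamma0_mul_of_dvd _ hgn⟩ =
      u ⟨(n : SL(2, ℤ)), mem_Gamma0_mul_of_dvd _ hn⟩ := by
  let gB : Gamma0 (L' * t) := ⟨(g : SL(2, ℤ)), mem_Gamma0_mul_of_dvd _ hgc⟩
  let nB : Gamma0 (L' * t) := ⟨(n : SL(2, ℤ)), mem_Gamma0_mul_of_dvd _ hn⟩
  have e : (⟨((g * n * g⁻¹ : Gamma0 L') : SL(2, ℤ)), mem_Gamma0_mul_of_dvd _ hgn⟩ : Gamma0 (L' * t)) = gB * nB * gB⁻¹ :=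
    Subtype.ext rfl
  rw [e, cocycle_zero_conj hu gB nB]

variable [NeZero L'] [NeZero t]
  (hshift : degeneracyPullback 0 (L' * t) (L' * t * t) t K dvd_rfl u = degeneracyPullback 0 (L' * t) (L' * t * t) 1 K (by simp) u)

include hshift

/-- **`u₁(g n g⁻¹) = u₁(n)` for `g ∈ Γ₀(L′)` with `t ∣ b_g` and `n ∈ Γ₀(L′)`, `n ≡ 1 (mod t)`** (the `B⁻`-half of §25.10
CHECK 1): shift `g` and `n` down by `A_t` into `Γ₀(L′t)`, conjugate there (class function), shift back up
(`apply_eq_of_shiftInvariant_d`).  The memberships of `n`, `g n g⁻¹` in `Γ₀(L′t)` are taken as data. [cite: Shimura1971, §8.3 (8.3.2)] -/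
theorem conj_invariant_of_dvd_b (g n : Gamma0 L') (hgb : (t : ℤ) ∣ (g : SL(2, ℤ)) 0 1)
    (hnb : (t : ℤ) ∣ (n : SL(2, ℤ)) 0 1)
    (hn : ((L' * t : ℕ) : ℤ) ∣ (n : SL(2, ℤ)) 1 0) (hgn : ((L' * t : ℕ) : ℤ) ∣ ((g * n * g⁻¹ : Gamma0 L') : SL(2, ℤ)) 1 0) :
    u ⟨((g * n * g⁻¹ : Gamma0 L') : SL(2, ℤ)), mem_Gamma0_mul_of_dvd _ hgn⟩ =
      u ⟨(n : SL(2, ℤ)), mem_Gamma0_mul_of_dvd _ hn⟩ := by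
  obtain ⟨g', hg'⟩ := exists_shiftDown g hgb
  obtain ⟨n', hn'⟩ := exists_shiftDown n hnb
  -- `g n g⁻¹` is the shift of `g' n' g'⁻¹`
  have hrel : ∀ {X : SL(2, ℤ)} {Y : SL(2, ℤ)},
      (X 0 0 = Y 0 0 ∧ X 0 1 = (t : ℤ) * Y 0 1 ∧ (t : ℤ) * X 1 0 = Y 1 0 ∧ X 1 1 = Y 1 1) ↔
      ((X : Matrix (Fin 2) (Fin 2) ℤ) 0 0 = (Y : Matrix (Fin 2) (Fin 2) ℤ) 0 0 ∧
        (X : Matrix (Fin 2) (Fin 2) ℤ) 0 1 = (t : ℤ) * (Y : Matrix (Fin 2) (Fin 2) ℤ) 0 1 ∧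
        (t : ℤ) * (X : Matrix (Fin 2) (Fin 2) ℤ) 1 0 = (Y : Matrix (Fin 2) (Fin 2) ℤ) 1 0 ∧
        (X : Matrix (Fin 2) (Fin 2) ℤ) 1 1 = (Y : Matrix (Fin 2) (Fin 2) ℤ) 1 1) := Iff.rfl
  have h1 : ((g : SL(2, ℤ)) * (n : SL(2, ℤ))) 0 0 = ((g' : SL(2, ℤ)) * (n' : SL(2, ℤ))) 0 0 ∧
      ((g : SL(2, ℤ)) * (n : SL(2, ℤ))) 0 1 = (t : ℤ) * ((g' : SL(2, ℤ)) * (n' : SL(2, ℤ))) 0 1 ∧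
      (t : ℤ) * ((g : SL(2, ℤ)) * (n : SL(2, ℤ))) 1 0 = ((g' : SL(2, ℤ)) * (n' : SL(2, ℤ))) 1 0 ∧
      ((g : SL(2, ℤ)) * (n : SL(2, ℤ))) 1 1 = ((g' : SL(2, ℤ)) * (n' : SL(2, ℤ))) 1 1 := by
    have := shiftRelMat_mul (t : ℤ) (hrel.mp hg') (hrel.mp hn')
    simpa only [Matrix.SpecialLinearGroup.coe_mul] using this
  have h2 := shiftRelMat_inv (t : ℤ) hg'
  have h3 : ((g : SL(2, ℤ)) * (n : SL(2, ℤ)) * (g : SL(2, ℤ))⁻¹) 0 0 = ((g' : SL(2, ℤ)) * (n' : SL(2, ℤ)) * (g' : SL(2, ℤ))⁻¹) 0 0 ∧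
      ((g : SL(2, ℤ)) * (n : SL(2, ℤ)) * (g : SL(2, ℤ))⁻¹) 0 1 =
        (t : ℤ) * ((g' : SL(2, ℤ)) * (n' : SL(2, ℤ)) * (g' : SL(2, ℤ))⁻¹) 0 1 ∧
      (t : ℤ) * ((g : SL(2, ℤ)) * (n : SL(2, ℤ)) * (g : SL(2, ℤ))⁻¹) 1 0 =
        ((g' : SL(2, ℤ)) * (n' : SL(2, ℤ)) * (g' : SL(2, ℤ))⁻¹) 1 0 ∧
      ((g : SL(2, ℤ)) * (n : SL(2, ℤ)) * (g : SL(2, ℤ))⁻¹) 1 1 = ((g' : SL(2, ℤ)) * (n' : SL(2, ℤ)) * (g' : SL(2, ℤ))⁻¹) 1 1 := by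
    have := shiftRelMat_mul (t : ℤ) (hrel.mp h1) (hrel.mp h2)
    simpa only [Matrix.SpecialLinearGroup.coe_mul] using this
  -- shift invariance twice, class function in between
  have e1 := apply_eq_of_shiftInvariant_d hshift (g' * n' * g'⁻¹) ⟨((g * n * g⁻¹ : Gamma0 L') : SL(2, ℤ)),
    mem_Gamma0_mul_of_dvd _ hgn⟩ h3
  have e2 := apply_eq_of_shiftInvariant_d hshift n' ⟨(n : SL(2, ℤ)), mem_Gamma0_mul_of_dvd _ hn⟩ hn'
  rw [e1, e2, cocycle_zero_conj hu g' n']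

/-- **`Γ₀(L′)`-INVARIANCE OF `u₁` ON `N = Γ₀(L′) ∩ Γ(t)`** (MEMO-es §25.10 (V-a)/CHECK 1, `t` any prime `∤ L′`): for a
`t`-shift-invariant homomorphism `u₁` on `Γ₀(L′t)`, every `g ∈ Γ₀(L′)` and every `n ∈ Γ₀(L′)` with `n ≡ 1 (mod t)` satisfy
`u₁(g n g⁻¹) = u₁(n)`.  Route: `Γ₀(L′) = B · B⁻ · B` explicitly (`g = T^x g⁻` if `t ∤ d_g`, else `g = T^x g⁻ T⁻¹`), with
`conj_invariant_of_dvd_c` on `B = Γ₀(L′t)` and `conj_invariant_of_dvd_b` on `B⁻ = {t ∣ b}`. [cite: Shimura1971, §8.3 (8.3.2)] -/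
theorem conj_invariant_of_shiftInvariant (htp : t.Prime) (hcop : Nat.Coprime t L') (g n : Gamma0 L')
    (hn1 : Matrix.SpecialLinearGroup.map (Int.castRingHom (ZMod t)) (n : SL(2, ℤ)) = 1) :
    u ⟨((g * n * g⁻¹ : Gamma0 L') : SL(2, ℤ)), mem_Gamma0_mul_of_dvd _ (dvd_level_conj_of_reduce_eq_one hcop g n hn1).2⟩ =
      u ⟨(n : SL(2, ℤ)), mem_Gamma0_mul_of_dvd _
        (dvd_level_of_reduce_eq_one hcop n ((reduce_eq_one_iff _).1 hn1).2.2.1)⟩ := by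
  classical
  have ht0 : t ≠ 0 := htp.ne_zero
  haveI : Fact t.Prime := ⟨htp⟩
  -- the statement for a fixed `g` and ALL kernel elements `n`
  let P : Gamma0 L' → Prop := fun g => ∀ (n : Gamma0 L')
    (hn1 : Matrix.SpecialLinearGroup.map (Int.castRingHom (ZMod t)) (n : SL(2, ℤ)) = 1),
    u ⟨((g * n * g⁻¹ : Gamma0 L') : SL(2, ℤ)), mem_Gamma0_mul_of_dvd _ (dvd_level_conj_of_reduce_eq_one hcop g n hn1).2⟩ =
      u ⟨(n : SL(2, ℤ)), mem_Gamma0_mul_of_dvd _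
        (dvd_level_of_reduce_eq_one hcop n ((reduce_eq_one_iff _).1 hn1).2.2.1)⟩
  -- closure under products
  have hmul : ∀ g₁ g₂, P g₁ → P g₂ → P (g₁ * g₂) := by
    intro g₁ g₂ h₁ h₂ n hn1
    have hn2 := (dvd_level_conj_of_reduce_eq_one hcop g₂ n hn1).1
    have e : (⟨(((g₁ * g₂) * n * (g₁ * g₂)⁻¹ : Gamma0 L') : SL(2, ℤ)),
        mem_Gamma0_mul_of_dvd _ (dvd_level_conj_of_reduce_eq_one hcop (g₁ * g₂) n hn1).2⟩ : Gamma0 (L' * t)) =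
        ⟨((g₁ * (g₂ * n * g₂⁻¹) * g₁⁻¹ : Gamma0 L') : SL(2, ℤ)),
          mem_Gamma0_mul_of_dvd _ (dvd_level_conj_of_reduce_eq_one hcop g₁ _ hn2).2⟩ := by
      apply Subtype.ext
      push_cast
      group
    rw [e, h₁ _ hn2, h₂ n hn1]
  -- `B`: `t ∣ c_g` (then `L′t ∣ c_g`)
  have hB : ∀ g : Gamma0 L', (t : ℤ) ∣ (g : SL(2, ℤ)) 1 0 → P g := by
    intro g hgc n hn1
    have hgc' : ((L' * t : ℕ) : ℤ) ∣ (g : SL(2, ℤ)) 1 0 :=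
      dvd_level_of_reduce_eq_one hcop g ((ZMod.intCast_zmod_eq_zero_iff_dvd _ _).2 hgc)
    exact conj_invariant_of_dvd_c hu g n hgc'
      (dvd_level_of_reduce_eq_one hcop n ((reduce_eq_one_iff _).1 hn1).2.2.1) (dvd_level_conj_of_reduce_eq_one hcop g n hn1).2
  -- `B⁻`: `t ∣ b_g`
  have hBm : ∀ g : Gamma0 L', (t : ℤ) ∣ (g : SL(2, ℤ)) 0 1 → P g := by
    intro g hgb n hn1
    have hnb : (t : ℤ) ∣ (n : SL(2, ℤ)) 0 1 := (ZMod.intCast_zmod_eq_zero_iff_dvd _ _).1 ((reduce_eq_one_iff _).1 hn1).2.1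
    exact conj_invariant_of_dvd_b hu hshift g n hgb hnb
      (dvd_level_of_reduce_eq_one hcop n ((reduce_eq_one_iff _).1 hn1).2.2.1) (dvd_level_conj_of_reduce_eq_one hcop g n hn1).2
  -- the translation `T^x ∈ B`
  have hT : ∀ x : ℤ, P ⟨ModularGroup.T ^ x, by rw [Gamma0_mem, ModularGroup.coe_T_zpow]; simp⟩ := by
    intro x
    refine hB _ ?_
    show (t : ℤ) ∣ ((ModularGroup.T ^ x : SL(2, ℤ)) : Matrix (Fin 2) (Fin 2) ℤ) 1 0
    rw [ModularGroup.coe_T_zpow]; simp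
  -- decomposition `g = T^x · g⁻` when `t ∤ d_g`
  have hdec : ∀ g : Gamma0 L', ¬ (t : ℤ) ∣ (g : SL(2, ℤ)) 1 1 → P g := by
    intro g hd
    -- `x ≡ b d⁻¹ (mod t)`
    have hdu : IsUnit ((((g : SL(2, ℤ)) 1 1 : ℤ)) : ZMod t) := by
      rw [isUnit_iff_ne_zero, Ne, ZMod.intCast_zmod_eq_zero_iff_dvd]; exact hd
    let x : ℤ := (((((g : SL(2, ℤ)) 0 1 : ℤ) : ZMod t) * ((((g : SL(2, ℤ)) 1 1 : ℤ) : ZMod t))⁻¹).val : ℤ)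
    have hx : ((x : ℤ) : ZMod t) * ((((g : SL(2, ℤ)) 1 1 : ℤ)) : ZMod t) = (((g : SL(2, ℤ)) 0 1 : ℤ) : ZMod t) := by
      simp only [x, Int.cast_natCast, ZMod.natCast_zmod_val]
      rw [mul_assoc, ZMod.inv_mul_of_unit _ hdu, mul_one]
    let Tx : Gamma0 L' := ⟨ModularGroup.T ^ x, by rw [Gamma0_mem, ModularGroup.coe_T_zpow]; simp⟩
    let gm : Gamma0 L' := Tx⁻¹ * g
    have hTg : ((g : SL(2, ℤ)) : Matrix (Fin 2) (Fin 2) ℤ) =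
        ((ModularGroup.T ^ x : SL(2, ℤ)) : Matrix (Fin 2) (Fin 2) ℤ) * ((gm : SL(2, ℤ)) : Matrix (Fin 2) (Fin 2) ℤ) := by
      have : g = Tx * gm := by simp [gm]
      conv_lhs => rw [this]
      rfl
    have e01 : ((g : SL(2, ℤ)) 0 1 : ℤ) = (gm : SL(2, ℤ)) 0 1 + x * (gm : SL(2, ℤ)) 1 1 := by
      have := congrArg (fun M : Matrix (Fin 2) (Fin 2) ℤ => M 0 1) hTg
      simp [ModularGroup.coe_T_zpow, Matrix.mul_apply, Fin.sum_univ_two] at this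
      linear_combination this
    have e11 : ((g : SL(2, ℤ)) 1 1 : ℤ) = (gm : SL(2, ℤ)) 1 1 := by
      have := congrArg (fun M : Matrix (Fin 2) (Fin 2) ℤ => M 1 1) hTg
      simp [ModularGroup.coe_T_zpow, Matrix.mul_apply, Fin.sum_univ_two] at this
      linear_combination this
    have hgm : (t : ℤ) ∣ (gm : SL(2, ℤ)) 0 1 := by
      have e : ((gm : SL(2, ℤ)) 0 1 : ℤ) = (g : SL(2, ℤ)) 0 1 - x * (g : SL(2, ℤ)) 1 1 := by
        rw [e01, e11]; ring
      rw [← ZMod.intCast_zmod_eq_zero_iff_dvd, e]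
      push_cast
      rw [← hx]; ring
    have e : g = Tx * gm := by simp [gm]
    rw [e]
    exact hmul Tx gm (hT x) (hBm gm hgm)
  by_cases hd : (t : ℤ) ∣ (g : SL(2, ℤ)) 1 1
  · -- `g T` has `d = c + d ≢ 0`: `t ∤ c` since `gcd(c, d) = 1`
    let T1 : Gamma0 L' := ⟨ModularGroup.T ^ (1 : ℤ), by rw [Gamma0_mem, ModularGroup.coe_T_zpow]; simp⟩
    have hgT : ¬ (t : ℤ) ∣ ((g * T1 : Gamma0 L') : SL(2, ℤ)) 1 1 := by
      have e : (((g * T1 : Gamma0 L') : SL(2, ℤ)) 1 1 : ℤ) = (g : SL(2, ℤ)) 1 0 + (g : SL(2, ℤ)) 1 1 := by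
        show (((g : SL(2, ℤ)) * ModularGroup.T ^ (1 : ℤ) : SL(2, ℤ)) : Matrix (Fin 2) (Fin 2) ℤ) 1 1 = _
        rw [zpow_one, Matrix.SpecialLinearGroup.coe_mul, ModularGroup.coe_T]
        simp [Matrix.mul_apply, Fin.sum_univ_two]
      rw [e]
      intro h
      have hc : (t : ℤ) ∣ (g : SL(2, ℤ)) 1 0 := (dvd_add_left hd).1 h
      -- `t ∣ c`, `t ∣ d` contradicts `a d - b c = 1`
      have hdet := Matrix.SpecialLinearGroup.det_coe (g : SL(2, ℤ))
      rw [Matrix.det_fin_two] at hdet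
      have : (t : ℤ) ∣ 1 := by
        rw [← hdet]; exact (hd.mul_left _).sub (hc.mul_left _)
      exact htp.one_lt.ne' (by exact_mod_cast Int.eq_one_of_dvd_one (by positivity) this)
    have e : g = (g * T1) * T1⁻¹ := by group
    rw [e]
    refine hmul _ _ (hdec _ hgT) ?_ n hn1
    have : T1⁻¹ = ⟨ModularGroup.T ^ (-1 : ℤ), by rw [Gamma0_mem, ModularGroup.coe_T_zpow]; simp⟩ :=
      Subtype.ext (by show (ModularGroup.T ^ (1 : ℤ))⁻¹ = ModularGroup.T ^ (-1 : ℤ); rw [zpow_neg])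
    rw [this]; exact hT (-1)
  · exact hdec g hd n hn1

end Invariance

end

end Summit.BirchSwinnertonDyer.BirchSwinnertonDyer.Theorems.ManinLocalTwoThree
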